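import Summits.BirchSwinnertonDyer.BirchSwinnertonDyer.Theorems.TwoAdicConverseTwoTorsionIsogenyPairs
import Literature.NumberTheory.EllipticCurves.Rank1Residual.Typed.X5DescentShapes
import HarnessLib

/-!
# Route `ByReductionTypeAtTwo` (rung K4), item 19095 `GoodOrdinaryRankZeroAtTwo` (BSD₂ at a good ordinary `2`, `r_an = 0`):
# the rational-`2`-torsion stratum organised by `ℤ/2`-linked PAIRS — BSD₂ is a property of the pair (Cassels + GZK),
# so the «neither» Greenberg configuration is eliminated on the FORMULA axis as well

Cell `bsd-2adic`, seat `bsd-2adic-conv-1` (GEN 19; the S3 companion file is `TwoAdicConverseTwoTorsionIsogenyPairs`).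
THEOREMS ONLY; `--supports stmt-BirchSwinnertonDyer-19095`.  HONEST FRAMING: BSD is not proved by any of this; item
19095 and its halves (19271 `OrdKatoHalfAtTwo`, 19272/19577) stay OPEN; every binder below is a research statement or a
printed fact displayed BY NAME (GZK `rank_eq_analyticRank_of_analyticRank_le_one`, Cassels `bsdRHS_eq_of_isIsogenous`,
modularity `hasEntireLFunction_rat`).  PARTITION (D-0054): none — FORMULA axis (K4) × stratum (β) = «E(ℚ)[2] ≠ 0» at
good-ordinary `2` (the door (34-PRIM)'s α-go habitat = the 83 MIXED classes; the 86 PURE classes are its complement).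

**Setting** (conv-1 GEN 19 currency): `C • W` a two-torsion normal form (`P = (C.r, C.t)`), `C' • W' =
(C • W).twoIsogenyCodomain` (`W'` globally minimal, `P' = (C'.r, C'.t)` the dual-kernel point); kernel facts:
`isIsogenous_of_twoTorsionPair`, `goodOrd_two_iff_of_twoTorsionPair`, `analyticRank_eq_of_twoTorsionPair`,
`hasCM_iff_of_twoTorsionPair`, and Greenberg's configurations DUAL along the pair (`neither_iff_ramified_and_odd_of_twoIsogeny`).

**Theorems.**
* §1 `bsdp_two_iff_of_twoTorsionPair` — for `r_an(W) ≤ 1`: `BSD(W,2) ⟺ BSD(W',2)` modulo PRINT {GZK, Cassels, modularity}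
  (the tree's `X5.bsdp_two_of_isIsogenous`, both directions).
* §2 **`goodOrd_twoTorsion_bsdp_of_mixed_of_ramifiedOdd`** — the (β) stratum of 19095: BSD₂ for every non-CM
  good-ordinary-at-`2` curve of analytic rank `0` with a rational point of order `2` follows from BSD₂ on (M) the curves
  carrying a Prop-5.14 point (the door (34-PRIM) habitat, `μ = 0` in print) and on (R) the curves carrying a Prop-5.13 point
  (`μ ≥ 1`) — «neither» members are reached through their partner; `r_an ≤ 1` form
  `goodOrd_twoTorsion_bsdp_le_one_of_mixed_of_ramifiedOdd` (covers the `r_an = 1` items of K4 on (β) as well).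

References: Greenberg LNM 1716 §5 Props. 5.13–5.14 [GreenbergLNM1716]; Cassels, Arithmetic on curves of genus 1 (VIII)
/ Milne ADT I.7.3 [MilneADT2006]; Silverman *AEC* III.4.5, VIII.8.3 [SilvermanAEC2009].
-/

set_option linter.dupNamespace false  -- `BirchSwinnertonDyer.BirchSwinnertonDyer` is the sub's path (D-0017)
set_option autoImplicit false

noncomputable section

open scoped Classical
open WeierstrassCurve Literature Literature.NumberTheory.EllipticCurves
  Literature.NumberTheory.EllipticCurves.Rank1Residual
  Literature.NumberTheory.EllipticCurves.Rank1Residual.Typed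
  Literature.NumberTheory.EllipticCurves.Greenberg1999

namespace Summit.BirchSwinnertonDyer.BirchSwinnertonDyer.Theorems.TwoAdicOffHabitat

/-! ## §1 BSD₂ is a property of the `ℤ/2`-linked pair (analytic rank `≤ 1`) -/

section Pair

variable {W W' : WeierstrassCurve ℚ} [W.IsElliptic] [W.IsGloballyMinimal] [W'.IsElliptic] [W'.IsGloballyMinimal]
  {C C' : VariableChange ℚ}

/-- **`BSD(W,2) ⟺ BSD(W',2)` on a `ℤ/2`-linked pair of analytic rank `≤ 1`**, modulo PRINT {GZK, Cassels, modularity}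
(the tree's `X5.bsdp_two_of_isIsogenous` in both directions; the analytic ranks agree along the pair).
[cite: MilneADT2006, Thm. I.7.3] [cite: Cassels1965ArithmeticVIII] -/
theorem bsdp_two_iff_of_twoTorsionPair (hGZK : rank_eq_analyticRank_of_analyticRank_le_one)
    (hCassels : bsdRHS_eq_of_isIsogenous) (hmod : hasEntireLFunction_rat) [(C • W).IsTwoTorsionNF]
    (hlink : C' • W' = (C • W).twoIsogenyCodomain) (hr : W.analyticRank ≤ 1) : BSDp W 2 ↔ BSDp W' 2 := by
  have hiso := isIsogenous_of_twoTorsionPair hlink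
  have hr' : W'.analyticRank ≤ 1 := (analyticRank_eq_of_twoTorsionPair hlink) ▸ hr
  exact ⟨fun h ↦ (X5.bsdp_two_of_isIsogenous W' hGZK hCassels hmod hiso.symm_of_charZero hr h).2,
    fun h ↦ (X5.bsdp_two_of_isIsogenous W hGZK hCassels hmod hiso hr' h).2⟩

end Pair

/-! ## §2 The (β) stratum of item 19095 shrinks to the two Greenberg configurations -/

/-- **BSD₂ on stratum (β), analytic rank `≤ 1`, from TWO configurations** (modulo PRINT {GZK, Cassels, modularity}):
if `BSD(V,2)` holds for every non-CM good-ordinary-at-`2` minimal `V` with `r_an(V) ≤ 1` carrying (M) a Prop-5.14 point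
and for every such `V` carrying (R) a Prop-5.13 point, then it holds for every non-CM good-ordinary-at-`2` minimal `V` with
`r_an(V) ≤ 1` and a rational point of order `2` (a «neither» point is traded for the partner's 5.13 point; `r_an`,
good-ordinary reduction and CM are isogeny invariants and BSD₂ transports by Cassels + GZK).
[cite: GreenbergLNM1716, Props. 5.13–5.14 (chunks p0168–p0170)] [cite: MilneADT2006, Thm. I.7.3] -/
theorem goodOrd_twoTorsion_bsdp_le_one_of_mixed_of_ramifiedOdd (hGZK : rank_eq_analyticRank_of_analyticRank_le_one)
    (hCassels : bsdRHS_eq_of_isIsogenous) (hmod : hasEntireLFunction_rat)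
    (hM : ∀ (V : WeierstrassCurve ℚ) [V.IsElliptic] [V.IsGloballyMinimal], ¬ V.HasCM → V.analyticRank ≤ 1 →
      GoodOrd V 2 → (∃ x : ℚ, HasRationalTwoTorsionX V x ∧
        ((TwoTorsionRamifiedAtTwo x ∧ ¬ TwoTorsionOdd V x) ∨ (TwoTorsionOdd V x ∧ ¬ TwoTorsionRamifiedAtTwo x))) →
      BSDp V 2)
    (hR : ∀ (V : WeierstrassCurve ℚ) [V.IsElliptic] [V.IsGloballyMinimal], ¬ V.HasCM → V.analyticRank ≤ 1 →
      GoodOrd V 2 → (∃ x : ℚ, HasRationalTwoTorsionX V x ∧ TwoTorsionRamifiedAtTwo x ∧ TwoTorsionOdd V x) →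
      BSDp V 2) :
    ∀ (V : WeierstrassCurve ℚ) [V.IsElliptic] [V.IsGloballyMinimal], ¬ V.HasCM → V.analyticRank ≤ 1 →
      GoodOrd V 2 → (∃ P : V.toAffine.Point, P ≠ 0 ∧ 2 • P = 0) → BSDp V 2 := by
  intro W _ _ hCM hr hgo hP
  obtain ⟨x₀, y₀, hEq, h2⟩ := (exists_two_torsion_iff_exists_hasRationalTwoTorsionX W).mp hP
  by_cases hmix : (TwoTorsionRamifiedAtTwo x₀ ∧ ¬ TwoTorsionOdd W x₀) ∨
      (TwoTorsionOdd W x₀ ∧ ¬ TwoTorsionRamifiedAtTwo x₀)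
  · exact hM W hCM hr hgo ⟨x₀, ⟨y₀, hEq, h2⟩, hmix⟩
  by_cases hRO : TwoTorsionRamifiedAtTwo x₀ ∧ TwoTorsionOdd W x₀
  · exact hR W hCM hr hgo ⟨x₀, ⟨y₀, hEq, h2⟩, hRO⟩
  have hN : ¬ TwoTorsionRamifiedAtTwo x₀ ∧ ¬ TwoTorsionOdd W x₀ := by tauto
  set C : VariableChange ℚ := ⟨1, x₀, -W.a₁ / 2, y₀⟩ with hC
  have hns : W.toAffine.Nonsingular x₀ y₀ := (WeierstrassCurve.Affine.equation_iff_nonsingular).mp hEq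
  have hy₀ : y₀ = W.toAffine.negY x₀ y₀ := by
    rw [WeierstrassCurve.Affine.negY]; linear_combination h2
  haveI hNF : (C • W).IsTwoTorsionNF := isTwoTorsionNF_smul_of_two_nsmul_eq_zero two_ne_zero hns hy₀
  obtain ⟨C₀, hmin⟩ := hasGlobalMinimalModel_rat_holds (C • W).twoIsogenyCodomain
  set W' : WeierstrassCurve ℚ := C₀ • (C • W).twoIsogenyCodomain with hW'
  haveI : W'.IsGloballyMinimal := hmin
  have hlink : C₀⁻¹ • W' = (C • W).twoIsogenyCodomain := inv_smul_smul C₀ _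
  haveI : (C₀⁻¹ • W').IsTwoTorsionNF := by rw [hlink]; infer_instance
  have hCr : C.r = x₀ := rfl
  have hgo' : GoodOrd W' 2 := (goodOrd_two_iff_of_twoTorsionPair hlink).mp hgo
  have hCM' : ¬ W'.HasCM := fun h ↦ hCM ((hasCM_iff_of_twoTorsionPair hlink).mpr h)
  have hr' : W'.analyticRank ≤ 1 := (analyticRank_eq_of_twoTorsionPair hlink) ▸ hr
  have ha₁ := odd_a₁_integralModelInt_of_goodOrd_or_mult W (Or.inl hgo)
  have ha₁' := odd_a₁_integralModelInt_of_goodOrd_or_mult W' (Or.inl hgo')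
  have hRO' : TwoTorsionRamifiedAtTwo C₀⁻¹.r ∧ TwoTorsionOdd W' C₀⁻¹.r :=
    (neither_iff_ramified_and_odd_of_twoIsogeny W W' C C₀⁻¹ ha₁ ha₁' hlink).mp (hCr ▸ hN)
  have hx' : HasRationalTwoTorsionX W' C₀⁻¹.r := hasRationalTwoTorsionX_of_isTwoTorsionNF_smul W' C₀⁻¹
  have h' : BSDp W' 2 := hR W' hCM' hr' hgo' ⟨C₀⁻¹.r, hx', hRO'⟩
  exact (bsdp_two_iff_of_twoTorsionPair hGZK hCassels hmod hlink hr).mpr h'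

/-- **The (β) stratum of item 19095 `GoodOrdinaryRankZeroAtTwo` (analytic rank `0`) from (M) and (R)**, modulo PRINT
{GZK, Cassels, modularity}. [cite: GreenbergLNM1716, Props. 5.13–5.14 (chunks p0168–p0170)] [cite: MilneADT2006, Thm. I.7.3] -/
theorem goodOrd_twoTorsion_bsdp_of_mixed_of_ramifiedOdd (hGZK : rank_eq_analyticRank_of_analyticRank_le_one)
    (hCassels : bsdRHS_eq_of_isIsogenous) (hmod : hasEntireLFunction_rat)
    (hM : ∀ (V : WeierstrassCurve ℚ) [V.IsElliptic] [V.IsGloballyMinimal], ¬ V.HasCM → V.analyticRank = 0 →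
      GoodOrd V 2 → (∃ x : ℚ, HasRationalTwoTorsionX V x ∧
        ((TwoTorsionRamifiedAtTwo x ∧ ¬ TwoTorsionOdd V x) ∨ (TwoTorsionOdd V x ∧ ¬ TwoTorsionRamifiedAtTwo x))) →
      BSDp V 2)
    (hR : ∀ (V : WeierstrassCurve ℚ) [V.IsElliptic] [V.IsGloballyMinimal], ¬ V.HasCM → V.analyticRank = 0 →
      GoodOrd V 2 → (∃ x : ℚ, HasRationalTwoTorsionX V x ∧ TwoTorsionRamifiedAtTwo x ∧ TwoTorsionOdd V x) →
      BSDp V 2) :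
    ∀ (V : WeierstrassCurve ℚ) [V.IsElliptic] [V.IsGloballyMinimal], ¬ V.HasCM → V.analyticRank = 0 →
      GoodOrd V 2 → (∃ P : V.toAffine.Point, P ≠ 0 ∧ 2 • P = 0) → BSDp V 2 := by
  intro W _ _ hCM hr hgo hP
  obtain ⟨x₀, y₀, hEq, h2⟩ := (exists_two_torsion_iff_exists_hasRationalTwoTorsionX W).mp hP
  by_cases hmix : (TwoTorsionRamifiedAtTwo x₀ ∧ ¬ TwoTorsionOdd W x₀) ∨
      (TwoTorsionOdd W x₀ ∧ ¬ TwoTorsionRamifiedAtTwo x₀)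
  · exact hM W hCM hr hgo ⟨x₀, ⟨y₀, hEq, h2⟩, hmix⟩
  by_cases hRO : TwoTorsionRamifiedAtTwo x₀ ∧ TwoTorsionOdd W x₀
  · exact hR W hCM hr hgo ⟨x₀, ⟨y₀, hEq, h2⟩, hRO⟩
  have hN : ¬ TwoTorsionRamifiedAtTwo x₀ ∧ ¬ TwoTorsionOdd W x₀ := by tauto
  set C : VariableChange ℚ := ⟨1, x₀, -W.a₁ / 2, y₀⟩ with hC
  have hns : W.toAffine.Nonsingular x₀ y₀ := (WeierstrassCurve.Affine.equation_iff_nonsingular).mp hEq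
  have hy₀ : y₀ = W.toAffine.negY x₀ y₀ := by
    rw [WeierstrassCurve.Affine.negY]; linear_combination h2
  haveI hNF : (C • W).IsTwoTorsionNF := isTwoTorsionNF_smul_of_two_nsmul_eq_zero two_ne_zero hns hy₀
  obtain ⟨C₀, hmin⟩ := hasGlobalMinimalModel_rat_holds (C • W).twoIsogenyCodomain
  set W' : WeierstrassCurve ℚ := C₀ • (C • W).twoIsogenyCodomain with hW'
  haveI : W'.IsGloballyMinimal := hmin
  have hlink : C₀⁻¹ • W' = (C • W).twoIsogenyCodomain := inv_smul_smul C₀ _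
  haveI : (C₀⁻¹ • W').IsTwoTorsionNF := by rw [hlink]; infer_instance
  have hCr : C.r = x₀ := rfl
  have hgo' : GoodOrd W' 2 := (goodOrd_two_iff_of_twoTorsionPair hlink).mp hgo
  have hCM' : ¬ W'.HasCM := fun h ↦ hCM ((hasCM_iff_of_twoTorsionPair hlink).mpr h)
  have hr' : W'.analyticRank = 0 := (analyticRank_eq_of_twoTorsionPair hlink) ▸ hr
  have ha₁ := odd_a₁_integralModelInt_of_goodOrd_or_mult W (Or.inl hgo)
  have ha₁' := odd_a₁_integralModelInt_of_goodOrd_or_mult W' (Or.inl hgo')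
  have hRO' : TwoTorsionRamifiedAtTwo C₀⁻¹.r ∧ TwoTorsionOdd W' C₀⁻¹.r :=
    (neither_iff_ramified_and_odd_of_twoIsogeny W W' C C₀⁻¹ ha₁ ha₁' hlink).mp (hCr ▸ hN)
  have hx' : HasRationalTwoTorsionX W' C₀⁻¹.r := hasRationalTwoTorsionX_of_isTwoTorsionNF_smul W' C₀⁻¹
  have h' : BSDp W' 2 := hR W' hCM' hr' hgo' ⟨C₀⁻¹.r, hx', hRO'⟩
  exact (bsdp_two_iff_of_twoTorsionPair hGZK hCassels hmod hlink (by omega)).mpr h'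

end Summit.BirchSwinnertonDyer.BirchSwinnertonDyer.Theorems.TwoAdicOffHabitat

end
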